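import Literature.RepresentationTheory.FiniteGroups.GL2ModularPrincipalSeriesCoordTwist
import Literature.RepresentationTheory.FiniteGroups.GL2ModularPrincipalSeriesCoordDuality
import Literature.RepresentationTheory.FiniteGroups.GL2ModularPrincipalSeriesLatticeUniqueSubrep
import Literature.NumberTheory.EllipticCurves.Kato2004.SemilocalDecompositionProofs
import HarnessLib

/-!
# Route `TeichmullerTwistDescent` — definitions posited by the route: the TAME-TYPE LATTICE DATUM of the
# F″-free K-line (crux K `TwistedPeriodLatticeSaturation`, stmt-BirchSwinnertonDyer-25368)

Cell `pub/bsd-wall` (D-0145 line route-BirchSwinnertonDyer-TeichmullerTwistDescent, OPEN rev 7), seat `bsd-line-ttd-p1`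
(prover 1/2, g22).  THREE DEFINITIONS (a `Prop`-valued predicate `ReductionSocleLe` and two hypothesis structures `TameTypeLatticeDatum` (homology side) /
`TameTypeCohomologyLatticeDatum` (cohomology side, appended g22), the
«hypothesis fields» pattern of `ModularParametrizationData`), no theorem, no named fact, no instance, no notation, no `sorry`.  BSD is not proved by
this; K / GE11 / Manin are not proved by this; the structure ASSERTS nothing — it only names the datum whose existence at
an instance `(Λ(f), Λ(f⊗χ), g(χ))` excludes «case one» `gΛ(f⊗χ) ⊆ pΛ(f)` by the landed theorem
`TypeLatticeNoCaseOne.not_caseOne_of_typeLatticeDatum` (its hypotheses are exactly the fields below).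

Mathematical content (ttd-p1 g14 `MECHANISM-K-lattice`, g19 `AUDIT-K-MECHANISM` §1/§4/§7, g22 `KLINE-COMPOSED` §2 —
evidence on 25368): for the optimal curve `W` of potentially good ordinary reduction at `p` with étale exponent
`b` (`ρ̄_W|I_p ∼ (ω^{1−b} ∗; 0 ω^b)`, `b = (p−1)·ord_pΔ_min/12`, UNSTARRED ⟺ `2b < p−1`), the `f_W`-part `Λ_Q` of the
homology of `Y(K(p)K₀(M))` with `ℤ_p`-coefficients is a `GL₂(𝔽_p)`-stable lattice in the tame principal-series type
`Ind(ω̃^{−b} ⊗ ω̃^{b})` [Bump1997, §4.1] whose reduction has socle the constituent `Sym^{2b} ⊗ det^{−b}`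
[EmertonGeeSavitt2015, §3–4] (weights in cohomology), and whose torus lines are the period lattices `Λ(f) ⊗ ℤ_p`,
`Λ(f⊗χ) ⊗ ℤ_p`, the twisting operator `Σ_a χ(a)u(a)` inducing multiplication by the Gauss sum.  The fields:

* `b`, `hb`, `hb2` — the exponent, unstarred;
* `hsurj`, `halg` — the residue algebra `ℤ_p → k` is onto and factors through `toZMod`;
* `Λ'`, `m`, `hm` — a `GL₂(𝔽_p)`-stable `ℤ_p`-submodule of finite index of the Bruhat-coordinate model
  `coordRep (ω̃^{p−1−b}) (ω̃ᵇ)` on `Option 𝔽_p → ℤ_p`;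
* `hsoc` — every nonzero stable `ℤ_p`-submodule of `Λ'/pΛ'` receives `Sym^{2b}(k²) ⊗ (χ̄₁∘det)` injectively and
  equivariantly (verbatim the hypothesis of `GL2.subrepresentation_coordRep_eq_pow_smul_top`);
* `βW`, `hβW` — an additive map from `Λf` into the `T`-invariants of `Λ'`;
* `βV`, `hβV` — an additive map from `Λfχ` whose image `ℤ_p`-spans over the `χ∘det`-eigenvectors of `Λ'`
  (`χ = ω̃^{(p−1)/2}` the quadratic character);
* `hframe`, `hβ` — `g·Λfχ ⊆ Λf` and `βW(g·w) = T_χ(βV(w))` with `T_χ = coordTwistOp _ _ χ`.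
-/

set_option autoImplicit false
-- single-conjunct summit: `Summit.BirchSwinnertonDyer.BirchSwinnertonDyer.…` repeats the name by design
set_option linter.dupNamespace false

noncomputable section

open scoped Pointwise

open Function
open Literature.RepresentationTheory.FiniteGroups Literature.RepresentationTheory.FiniteGroups.GL2
open Literature.NumberTheory.EllipticCurves (Kato2004.teichmullerChar)

namespace Summit.BirchSwinnertonDyer.BirchSwinnertonDyer.Theorems.TeichmullerTwistDescent

/-- **The reduction-socle condition** on a `GL₂(𝔽_p)`-stable `ℤ_p`-lattice `Λ'` of the coordinate model
`coordRep χ₁ χ₂`: every nonzero stable `ℤ_p`-submodule of `Λ'/pΛ'` receives an injective `ℤ_p`-linear equivariant map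
from `Sym^r(k²) ⊗ (χ̄₁∘det)` — i.e. the socle of the reduction is `⊆ {Sym^r ⊗ χ̄₁∘det}`; verbatim the hypothesis `hsoc`
of `GL2.subrepresentation_coordRep_eq_pow_smul_top` with `R = ℤ_p`, `ϖ = p`. [cite: EmertonGeeSavitt2015, Lemma 4.1.1] -/
def ReductionSocleLe (p : ℕ) [Fact p.Prime] (k : Type) [Field k] [CharP k p] [Algebra ℤ_[p] k]
    (χ₁ χ₂ : (ZMod p)ˣ →* ℤ_[p]ˣ) (r : ℕ) (Λ' : Subrepresentation (coordRep χ₁ χ₂)) : Prop :=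
  ∀ N : Submodule ℤ_[p] (↥Λ'.toSubmodule ⧸ ((p : ℤ_[p]) • Λ'.toSubmodule).comap Λ'.toSubmodule.subtype),
    (∀ (γ : GL (Fin 2) (ZMod p)) (x : ↥Λ'.toSubmodule), Submodule.Quotient.mk x ∈ N →
      Submodule.Quotient.mk (⟨coordRep χ₁ χ₂ γ x, Λ'.apply_mem_toSubmodule γ x.2⟩ : ↥Λ'.toSubmodule) ∈ N) →
    N ≠ ⊥ →
    ∃ f : ↥(MvPolynomial.homogeneousSubmodule (Fin 2) k r) →ₗ[ℤ_[p]]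
        (↥Λ'.toSubmodule ⧸ ((p : ℤ_[p]) • Λ'.toSubmodule).comap Λ'.toSubmodule.subtype),
      Injective f ∧ LinearMap.range f ≤ N ∧
      ∀ (γ : GL (Fin 2) (ZMod p)) (φ : ↥(MvPolynomial.homogeneousSubmodule (Fin 2) k r)) (x : ↥Λ'.toSubmodule),
        Submodule.Quotient.mk x = f φ →
        Submodule.Quotient.mk (⟨coordRep χ₁ χ₂ γ x, Λ'.apply_mem_toSubmodule γ x.2⟩ : ↥Λ'.toSubmodule) =
          f (symPowTwist (ZMod.castHom (dvd_refl p) k) (reduceChar k χ₁) r γ φ)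

/-- **Tame-type lattice datum** for a prime `p`, a residue field `k` of `ℤ_p`, two additive subgroups `Λf, Λfχ ⊆ ℂ`
(the period lattices of `f` and `f ⊗ χ`) and a complex number `g` (the Gauss sum): an unstarred exponent `b`, a
`GL₂(𝔽_p)`-stable `ℤ_p`-lattice `Λ'` of finite index in `coordRep (ω̃^{p−1−b}) (ω̃ᵇ)` with reduction socle
`⊆ {Sym^{2b} ⊗ χ̄₁∘det}`, and additive maps `βW : Λf → Λ'^T`, `βV : Λfχ → ℤ_p^{ℙ¹}` spanning over `Λ'^{T,χ∘det}` with
`βW(g·w) = T_χ(βV w)`.  Hypothesis structure (asserts nothing); its fields are exactly the hypotheses of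
`TypeLatticeNoCaseOne.not_caseOne_of_typeLatticeDatum`. [cite: EmertonGeeSavitt2015, Lemma 4.1.1] [cite: Bump1997, §4.1] -/
structure TameTypeLatticeDatum (p : ℕ) [Fact p.Prime] (k : Type) [Field k] [CharP k p] [Algebra ℤ_[p] k] [Finite k]
    (Λf Λfχ : AddSubgroup ℂ) (g : ℂ) where
  /-- the étale exponent `b` (`χ₁ = ω̃^{p−1−b}`, `χ₂ = ω̃ᵇ`) -/
  b : ℕ
  /-- `0 < b` -/
  hb : 0 < b
  /-- unstarred: `2b < p − 1` -/
  hb2 : 2 * b < p - 1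
  /-- the residue map `ℤ_p → k` is onto -/
  hsurj : Surjective (algebraMap ℤ_[p] k)
  /-- … and factors through `toZMod` -/
  halg : ∀ x : ℤ_[p], algebraMap ℤ_[p] k x = ZMod.castHom (dvd_refl p) k (PadicInt.toZMod x)
  /-- the stable lattice in the coordinate model of the type -/
  Λ' : Subrepresentation (coordRep (Kato2004.teichmullerChar p ^ (p - 1 - b)) (Kato2004.teichmullerChar p ^ b))
  /-- finite-index exponent -/
  m : ℕ
  /-- finite index: `p^m · ⊤ ⊆ Λ'` -/
  hm : ∀ v : Option (ZMod p) → ℤ_[p], (p : ℤ_[p]) ^ m • v ∈ Λ'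
  /-- socle of the reduction `⊆ {Sym^{2b} ⊗ χ̄₁∘det}` (`ReductionSocleLe`, the lattice theorem's hypothesis) -/
  hsoc : ReductionSocleLe p k (Kato2004.teichmullerChar p ^ (p - 1 - b)) (Kato2004.teichmullerChar p ^ b) (2 * b) Λ'
  /-- `g·Λfχ ⊆ Λf` (Stevens (5.4) for the period lattices) -/
  hframe : ∀ w ∈ Λfχ, g * w ∈ Λf
  /-- the `W`-side period-to-coordinates map -/
  βW : Λf →+ (Option (ZMod p) → ℤ_[p])
  /-- the `V = W ⊗ χ`-side period-to-coordinates map -/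
  βV : Λfχ →+ (Option (ZMod p) → ℤ_[p])
  /-- `βW` lands in the `T`-invariants of `Λ'` -/
  hβW : ∀ z : Λf, βW z ∈ Λ'.toSubmodule ⊓
    coordTorusEigenspace (Kato2004.teichmullerChar p ^ (p - 1 - b)) (Kato2004.teichmullerChar p ^ b)
      (fun _ _ => (1 : ℤ_[p]))
  /-- the image of `βV` spans (over `ℤ_p`) a module containing the `χ∘det`-eigenvectors of `Λ'` -/
  hβV : Λ'.toSubmodule ⊓
      coordTorusEigenspace (Kato2004.teichmullerChar p ^ (p - 1 - b)) (Kato2004.teichmullerChar p ^ b)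
        (fun a c : (ZMod p)ˣ => MulChar.ofUnitHom (Kato2004.teichmullerChar p ^ ((p - 1) / 2)) (a : ZMod p) *
          MulChar.ofUnitHom (Kato2004.teichmullerChar p ^ ((p - 1) / 2)) (c : ZMod p)) ≤
    Submodule.span ℤ_[p] (Set.range βV)
  /-- intertwining: `βW(g·w) = T_χ(βV w)` -/
  hβ : ∀ (w : ℂ) (hw : w ∈ Λfχ), βW ⟨g * w, hframe w hw⟩ =
    coordTwistOp (Kato2004.teichmullerChar p ^ (p - 1 - b)) (Kato2004.teichmullerChar p ^ b)
      (MulChar.ofUnitHom (Kato2004.teichmullerChar p ^ ((p - 1) / 2))) (βV ⟨w, hw⟩)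

/-- **Tame-type lattice datum, COHOMOLOGY side** (added g22, sequel `TeichmullerTwistDescentTypeLatticeCohomologySide`):
the same datum with the stable lattice given on the cohomology side — `Λc ⊆ coordRep (ω̃ᵇ) (ω̃^{p−1−b})` (the class of
`Λ_Q^* ↪ H¹(Y(K(p)K₀(M)), ℤ_p)_𝔪`) of finite index with reduction socle `⊆ {Sym^{p−1−2b} ⊗ ωᵇ∘det}` = the Serre weight
`C_W` (the form in which weights-in-cohomology deliver it) — and the period maps `βW`, `βV` landing in / spanning over
the torus lines of its dot-product dual `dualLattice Λc (p^m)` (the homology lattice; the invariant pairing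
`Ind(χ) × Ind(χ⁻¹)` is the dot product of Bruhat coordinates, `GL2ModularPrincipalSeriesCoordDuality`).  Fields = exactly
the hypotheses of `TypeLatticeCohomologySide.not_caseOne_of_cohomologyTypeLatticeDatum`; asserts nothing.
[cite: EmertonGeeSavitt2015, Lemma 4.1.1] [cite: Bump1997, §4.1] -/
structure TameTypeCohomologyLatticeDatum (p : ℕ) [Fact p.Prime] (k : Type) [Field k] [CharP k p] [Algebra ℤ_[p] k]
    [Finite k] (Λf Λfχ : AddSubgroup ℂ) (g : ℂ) where
  /-- the étale exponent `b` -/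
  b : ℕ
  /-- `0 < b` -/
  hb : 0 < b
  /-- unstarred: `2b < p − 1` -/
  hb2 : 2 * b < p - 1
  /-- the residue map `ℤ_p → k` is onto -/
  hsurj : Surjective (algebraMap ℤ_[p] k)
  /-- … and factors through `toZMod` -/
  halg : ∀ x : ℤ_[p], algebraMap ℤ_[p] k x = ZMod.castHom (dvd_refl p) k (PadicInt.toZMod x)
  /-- the stable lattice in the cohomology model `coordRep (ω̃ᵇ) (ω̃^{p−1−b})` -/
  Λc : Subrepresentation (coordRep (Kato2004.teichmullerChar p ^ b) (Kato2004.teichmullerChar p ^ (p - 1 - b)))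
  /-- finite-index exponent -/
  m : ℕ
  /-- finite index: `p^m · ⊤ ⊆ Λc` -/
  hm : ∀ v : Option (ZMod p) → ℤ_[p], (p : ℤ_[p]) ^ m • v ∈ Λc
  /-- socle of the reduction `⊆ {Sym^{p−1−2b} ⊗ χ̄₁∘det}` = the Serre weight `C_W` -/
  hsoc : ReductionSocleLe p k (Kato2004.teichmullerChar p ^ b) (Kato2004.teichmullerChar p ^ (p - 1 - b))
    (p - 1 - 2 * b) Λc
  /-- `g·Λfχ ⊆ Λf` -/
  hframe : ∀ w ∈ Λfχ, g * w ∈ Λf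
  /-- the `W`-side period-to-coordinates map (into the dual = homology lattice) -/
  βW : Λf →+ (Option (ZMod p) → ℤ_[p])
  /-- the `V`-side period-to-coordinates map -/
  βV : Λfχ →+ (Option (ZMod p) → ℤ_[p])
  /-- `βW` lands in the `T`-invariants of the dual lattice -/
  hβW : ∀ z : Λf, βW z ∈ dualLattice Λc.toSubmodule ((p : ℤ_[p]) ^ m) ⊓
    coordTorusEigenspace (Kato2004.teichmullerChar p ^ (p - 1 - b)) (Kato2004.teichmullerChar p ^ b)
      (fun _ _ => (1 : ℤ_[p]))
  /-- the image of `βV` spans over the `χ∘det`-eigenvectors of the dual lattice -/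
  hβV : dualLattice Λc.toSubmodule ((p : ℤ_[p]) ^ m) ⊓
      coordTorusEigenspace (Kato2004.teichmullerChar p ^ (p - 1 - b)) (Kato2004.teichmullerChar p ^ b)
        (fun a c : (ZMod p)ˣ => MulChar.ofUnitHom (Kato2004.teichmullerChar p ^ ((p - 1) / 2)) (a : ZMod p) *
          MulChar.ofUnitHom (Kato2004.teichmullerChar p ^ ((p - 1) / 2)) (c : ZMod p)) ≤
    Submodule.span ℤ_[p] (Set.range βV)
  /-- intertwining: `βW(g·w) = T_χ(βV w)` (twisting operator of the homology model) -/
  hβ : ∀ (w : ℂ) (hw : w ∈ Λfχ), βW ⟨g * w, hframe w hw⟩ =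
    coordTwistOp (Kato2004.teichmullerChar p ^ (p - 1 - b)) (Kato2004.teichmullerChar p ^ b)
      (MulChar.ofUnitHom (Kato2004.teichmullerChar p ^ ((p - 1) / 2))) (βV ⟨w, hw⟩)

end Summit.BirchSwinnertonDyer.BirchSwinnertonDyer.Theorems.TeichmullerTwistDescent
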